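import Mathlib.NumberTheory.Divisors
import Mathlib.Data.Nat.Factorization.Basic
import Mathlib.Tactic
import HarnessLib

/-!
# Coprime divisor pairs: `#{(d₀, d₁) : d₀ d₁ = m, gcd(d₀, d₁) = 1} = 2^{ω(m)}`

Elementary counting used for Lenstra–Pomerance 1992, Theorem 2.5 (the number of ambiguous
reduced forms). For `m ≥ 1` the ordered coprime factorizations `m = d₀ d₁` correspond to the
subsets `S` of the set of prime factors of `m` (`d₀ = ∏_{p ∈ S} p^{v_p(m)}`), so there are
`2^{ω(m)}` of them; for `m > 1` none has `d₀ = d₁`, so exactly half have `d₀ < d₁`.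
Everything is proved; no definitions, no named facts.
-/

namespace Literature.NumberTheory.QuadraticFields.BinaryQuadraticForm

open Finset

/-- The `S`-part `∏_{p ∈ S} p^{v_p(m)}` of `m` divides `m` (`S` a set of prime factors of `m`).
[folklore] -/
theorem prod_pow_factorization_dvd {m : ℕ} (hm : m ≠ 0) {S : Finset ℕ}
    (hS : S ⊆ m.primeFactors) : ∏ p ∈ S, p ^ m.factorization p ∣ m := by
  calc ∏ p ∈ S, p ^ m.factorization p ∣ ∏ p ∈ m.primeFactors, p ^ m.factorization p :=
        Finset.prod_dvd_prod_of_subset _ _ _ hS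
    _ = m := (Nat.prod_primeFactors_pow_factorization hm).symm

/-- The factorization of the `S`-part of `m`: `v_p = v_p(m)` for `p ∈ S`, `0` otherwise.
[folklore] -/
theorem factorization_prod_pow_factorization {m : ℕ} {S : Finset ℕ}
    (hS : S ⊆ m.primeFactors) (q : ℕ) :
    (∏ p ∈ S, p ^ m.factorization p).factorization q =
      if q ∈ S then m.factorization q else 0 := by
  have hprime : ∀ p ∈ S, p.Prime := fun p hp => Nat.prime_of_mem_primeFactors (hS hp)
  rw [Nat.factorization_prod (fun p hp => pow_ne_zero _ (hprime p hp).ne_zero),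
    Finset.sum_apply']
  rw [Finset.sum_congr rfl (g := fun p => if p = q then m.factorization p else 0)
    (fun p hp => by rw [(hprime p hp).factorization_pow, Finsupp.single_apply])]
  exact Finset.sum_ite_eq' S q _

/-- The set of prime factors of the `S`-part of `m` is `S`. [folklore] -/
theorem primeFactors_prod_pow_factorization {m : ℕ} {S : Finset ℕ}
    (hS : S ⊆ m.primeFactors) :
    (∏ p ∈ S, p ^ m.factorization p).primeFactors = S := by
  ext q
  rw [← Nat.support_factorization, Finsupp.mem_support_iff,
    factorization_prod_pow_factorization hS]
  constructor
  · intro h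
    by_contra hq
    exact h (if_neg hq)
  · intro hq
    rw [if_pos hq]
    have := Nat.mem_primeFactors.1 (hS hq)
    exact (Nat.Prime.factorization_pos_of_dvd this.1 this.2.2 this.2.1).ne'

/-- The `S`-part `d` of `m` and its cofactor `m / d` are coprime. [folklore] -/
theorem coprime_prod_pow_factorization_div {m : ℕ} (hm : m ≠ 0) {S : Finset ℕ}
    (hS : S ⊆ m.primeFactors) :
    Nat.Coprime (∏ p ∈ S, p ^ m.factorization p) (m / ∏ p ∈ S, p ^ m.factorization p) := by
  set d := ∏ p ∈ S, p ^ m.factorization p with hd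
  have hdvd : d ∣ m := prod_pow_factorization_dvd hm hS
  have hd0 : d ≠ 0 := fun h => hm (Nat.eq_zero_of_zero_dvd (h ▸ hdvd))
  have hmd0 : m / d ≠ 0 := (Nat.div_pos (Nat.le_of_dvd (Nat.pos_of_ne_zero hm) hdvd)
    (Nat.pos_of_ne_zero hd0)).ne'
  rw [← Nat.disjoint_primeFactors hd0 hmd0, primeFactors_prod_pow_factorization hS,
    Finset.disjoint_left]
  intro q hqS hq
  rw [← Nat.support_factorization, Finsupp.mem_support_iff, Nat.factorization_div hdvd,
    Finsupp.tsub_apply, factorization_prod_pow_factorization hS, if_pos hqS] at hq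
  exact hq (Nat.sub_self _)

/-- **`#{(d₀, d₁) : d₀ d₁ = m, gcd(d₀, d₁) = 1} = 2^{ω(m)}`** for `m ≠ 0`: the ordered coprime
factorizations of `m` are the `S`-parts of `m`, `S ⊆ {p prime : p ∣ m}`. [folklore] -/
theorem card_filter_coprime_divisorsAntidiagonal {m : ℕ} (hm : m ≠ 0) :
    #{x ∈ m.divisorsAntidiagonal | Nat.Coprime x.1 x.2} = 2 ^ m.primeFactors.card := by
  classical
  set φ : Finset ℕ → ℕ × ℕ := fun S =>
    (∏ p ∈ S, p ^ m.factorization p, m / ∏ p ∈ S, p ^ m.factorization p) with hφ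
  have himage : {x ∈ m.divisorsAntidiagonal | Nat.Coprime x.1 x.2} =
      m.primeFactors.powerset.image φ := by
    ext ⟨d₀, d₁⟩
    simp only [mem_filter, Nat.mem_divisorsAntidiagonal, mem_image, mem_powerset, hφ,
      Prod.mk.injEq]
    constructor
    · rintro ⟨⟨hprod, -⟩, hcop⟩
      have hd₀ : d₀ ≠ 0 := left_ne_zero_of_mul (hprod ▸ hm)
      have hd₀m : d₀ ∣ m := hprod ▸ dvd_mul_right d₀ d₁
      refine ⟨d₀.primeFactors, Nat.primeFactors_mono hd₀m hm, ?_, ?_⟩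
      · have h1 : ∏ p ∈ d₀.primeFactors, p ^ m.factorization p =
            ∏ p ∈ d₀.primeFactors, p ^ d₀.factorization p := by
          refine Finset.prod_congr rfl fun p hp => ?_
          rw [← hprod, Nat.factorization_eq_of_coprime_left hcop
            (Nat.mem_primeFactors_iff_mem_primeFactorsList.1 hp)]
        rw [h1, ← Nat.prod_primeFactors_pow_factorization hd₀]
      · have h1 : ∏ p ∈ d₀.primeFactors, p ^ m.factorization p = d₀ := by
          have : ∏ p ∈ d₀.primeFactors, p ^ m.factorization p =
              ∏ p ∈ d₀.primeFactors, p ^ d₀.factorization p := by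
            refine Finset.prod_congr rfl fun p hp => ?_
            rw [← hprod, Nat.factorization_eq_of_coprime_left hcop
              (Nat.mem_primeFactors_iff_mem_primeFactorsList.1 hp)]
          rw [this, ← Nat.prod_primeFactors_pow_factorization hd₀]
        rw [h1, ← hprod, Nat.mul_div_cancel_left _ (Nat.pos_of_ne_zero hd₀)]
    · rintro ⟨S, hS, rfl, rfl⟩
      have hdvd := prod_pow_factorization_dvd hm hS
      exact ⟨⟨Nat.mul_div_cancel' hdvd, hm⟩, coprime_prod_pow_factorization_div hm hS⟩
  rw [himage, Finset.card_image_of_injOn, Finset.card_powerset]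
  intro S hS T hT hST
  simp only [coe_powerset, Set.mem_preimage, Set.mem_powerset_iff, Finset.coe_subset] at hS hT
  have h1 := congrArg (fun x : ℕ × ℕ => x.1.primeFactors) hST
  simpa only [hφ, primeFactors_prod_pow_factorization hS,
    primeFactors_prod_pow_factorization hT] using h1

/-- A coprime factorization `m = d₀ d₁` with `d₀ = d₁` forces `m = 1`. [folklore] -/
theorem fst_ne_snd_of_coprime_of_mul_eq {m d₀ d₁ : ℕ} (hm : 1 < m) (hprod : d₀ * d₁ = m)
    (hcop : Nat.Coprime d₀ d₁) : d₀ ≠ d₁ := by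
  rintro rfl
  rw [Nat.coprime_self] at hcop
  subst hcop
  omega

/-- **Half of the coprime factorizations have `d₀ < d₁`**: for `m > 1`,
`#{(d₀, d₁) : d₀ d₁ = m, gcd = 1, d₀ < d₁} = 2^{ω(m) - 1}`. [folklore] -/
theorem card_filter_coprime_lt_divisorsAntidiagonal {m : ℕ} (hm : 1 < m) :
    #{x ∈ m.divisorsAntidiagonal | Nat.Coprime x.1 x.2 ∧ x.1 < x.2} =
      2 ^ (m.primeFactors.card - 1) := by
  have hm0 : m ≠ 0 := by omega
  set A := {x ∈ m.divisorsAntidiagonal | Nat.Coprime x.1 x.2 ∧ x.1 < x.2} with hA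
  set B := {x ∈ m.divisorsAntidiagonal | Nat.Coprime x.1 x.2 ∧ x.2 < x.1} with hB
  have hAB : #A = #B := by
    refine Finset.card_bij (fun x _ => x.swap) ?_ ?_ ?_
    · intro x hx
      simp only [hA, hB, mem_filter, Nat.mem_divisorsAntidiagonal] at hx ⊢
      refine ⟨⟨by rw [Prod.fst_swap, Prod.snd_swap, mul_comm]; exact hx.1.1, hx.1.2⟩, ?_, ?_⟩
      · simpa only [Prod.fst_swap, Prod.snd_swap] using hx.2.1.symm
      · simpa only [Prod.fst_swap, Prod.snd_swap] using hx.2.2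
    · intro x _ y _ h
      exact Prod.swap_injective h
    · intro y hy
      refine ⟨y.swap, ?_, Prod.swap_swap y⟩
      simp only [hA, hB, mem_filter, Nat.mem_divisorsAntidiagonal] at hy ⊢
      refine ⟨⟨by rw [Prod.fst_swap, Prod.snd_swap, mul_comm]; exact hy.1.1, hy.1.2⟩, ?_, ?_⟩
      · simpa only [Prod.fst_swap, Prod.snd_swap] using hy.2.1.symm
      · simpa only [Prod.fst_swap, Prod.snd_swap] using hy.2.2
  have hunion : {x ∈ m.divisorsAntidiagonal | Nat.Coprime x.1 x.2} = A ∪ B := by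
    ext x
    simp only [hA, hB, mem_union, mem_filter, Nat.mem_divisorsAntidiagonal]
    constructor
    · rintro ⟨hx, hcop⟩
      rcases lt_or_gt_of_ne (fst_ne_snd_of_coprime_of_mul_eq hm hx.1 hcop) with h | h
      · exact Or.inl ⟨hx, hcop, h⟩
      · exact Or.inr ⟨hx, hcop, h⟩
    · rintro (⟨hx, hcop, -⟩ | ⟨hx, hcop, -⟩) <;> exact ⟨hx, hcop⟩
  have hdisj : Disjoint A B := by
    rw [Finset.disjoint_left]
    intro x hxA hxB
    simp only [hA, hB, mem_filter] at hxA hxB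
    omega
  have hcard := card_filter_coprime_divisorsAntidiagonal hm0
  rw [hunion, Finset.card_union_of_disjoint hdisj, ← hAB] at hcard
  have hω : 1 ≤ m.primeFactors.card := by
    obtain ⟨p, hp⟩ := Nat.nonempty_primeFactors.2 hm
    exact Finset.card_pos.2 ⟨p, hp⟩
  have h2 : 2 ^ m.primeFactors.card = 2 * 2 ^ (m.primeFactors.card - 1) := by
    rw [← pow_succ']
    congr 1
    omega
  omega

/-- For `m > 1`, `d₀ ≤ d₁` and `d₀ < d₁` cut out the same coprime factorizations. [folklore] -/
theorem filter_coprime_le_eq_filter_coprime_lt {m : ℕ} (hm : 1 < m) :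
    {x ∈ m.divisorsAntidiagonal | Nat.Coprime x.1 x.2 ∧ x.1 ≤ x.2} =
      {x ∈ m.divisorsAntidiagonal | Nat.Coprime x.1 x.2 ∧ x.1 < x.2} := by
  ext x
  simp only [mem_filter, Nat.mem_divisorsAntidiagonal]
  constructor
  · rintro ⟨hx, hcop, hle⟩
    exact ⟨hx, hcop, lt_of_le_of_ne hle (fst_ne_snd_of_coprime_of_mul_eq hm hx.1 hcop)⟩
  · rintro ⟨hx, hcop, hlt⟩
    exact ⟨hx, hcop, hlt.le⟩

/-- `#{(d₀, d₁) : d₀ d₁ = m, gcd = 1, d₀ ≤ d₁} = 2^{ω(m) - 1}` for `m > 1`. [folklore] -/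
theorem card_filter_coprime_le_divisorsAntidiagonal {m : ℕ} (hm : 1 < m) :
    #{x ∈ m.divisorsAntidiagonal | Nat.Coprime x.1 x.2 ∧ x.1 ≤ x.2} =
      2 ^ (m.primeFactors.card - 1) := by
  rw [filter_coprime_le_eq_filter_coprime_lt hm, card_filter_coprime_lt_divisorsAntidiagonal hm]

/-- For `m = 1` the only factorization is `(1, 1)`: the `≤`-count is `1`. [folklore] -/
theorem card_filter_coprime_le_divisorsAntidiagonal_one :
    #{x ∈ (1 : ℕ).divisorsAntidiagonal | Nat.Coprime x.1 x.2 ∧ x.1 ≤ x.2} = 1 := by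
  decide

/-- For `m = 1` no factorization has `d₀ < d₁`. [folklore] -/
theorem card_filter_coprime_lt_divisorsAntidiagonal_one :
    #{x ∈ (1 : ℕ).divisorsAntidiagonal | Nat.Coprime x.1 x.2 ∧ x.1 < x.2} = 0 := by
  decide

end Literature.NumberTheory.QuadraticFields.BinaryQuadraticForm
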